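import Literature.NumberTheory.EllipticCurves.CanonicalPAdicHeightJunkSigmaProofs
import HarnessLib

/-!
# Uniqueness of a `2`-adic height datum from its quadratic form on deep points

Helpers for the route `ByReductionTypeAtTwo`, crux `RankOneAtTwoBigImageOddLocal`
(`--supports stmt-BirchSwinnertonDyer-23715`, cell bsd-f1-sign2, analytic lens): the companion of the
existence theorem `exists_heightData_sigmaSqZero_two` (`…SigmaSqHeightData.lean`).  A symmetric bilinear
torsion-killing pairing `PAdicHeightData W 2` is determined by its quadratic form on the points
`P = (x, y)` with `2⁸ ≤ ‖x‖₂` and non-singular reduction at every prime («`2`-admissible» points of the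
`η`-height law): every non-torsion point has a non-zero multiple of that kind, because an admissible
multiple exists (tree `exists_admissible_nsmul_of_isIntegral`) and DOUBLING multiplies `‖x‖₂` by at least
`4` on `E₁(ℚ₂)` (tree `four_mul_padicNorm_le_padicNorm_addX`); then scale by `m²` and polarise (tree
`PAdicHeightData.ext_of_sq_eq_on`).

## References
* [Mazur–Stein–Tate 2006, §1] («replace `P` by a multiple»; `h_p(nQ) = n² h_p(Q)`).
* [Silverman AEC 2009, VII.2.1–2.2, VII.6.1–6.2] (the filtration `E₁ ⊇ E₂ ⊇ ⋯`, finite indices).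
-/

namespace Summit.BirchSwinnertonDyer.BirchSwinnertonDyer.Theorems.NaiveSigmaLogAtTwo

open WeierstrassCurve

/-- **Deep admissible multiples at `2`**: for every non-torsion `P ∈ W(ℚ)` on a `ℤ`-integral elliptic
equation and every `k`, some non-zero multiple `m • P = (x, y)` is admissible at `2` with `4^k < ‖x‖₂`
(an admissible multiple, doubled `k` times: `‖x(2Q)‖₂ ≥ 4‖x(Q)‖₂` on `E₁(ℚ₂)`).
[cite: MazurSteinTate2006, §1] [cite: SilvermanAEC2009, VII.2.1] -/
theorem exists_nsmul_isAdmissible_two_norm_gt (W : WeierstrassCurve ℚ) [W.IsElliptic] [W.IsIntegral ℤ]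
    (P : W.toAffine.Point) (hP : ¬ IsOfFinAddOrder P) (k : ℕ) :
    ∃ m : ℕ, m ≠ 0 ∧ ∃ (x y : ℚ) (h : W.toAffine.Nonsingular x y),
      m • P = .some x y h ∧ W.IsAdmissible 2 (.some x y h) ∧ (4 : ℝ) ^ k < ‖(x : ℚ_[2])‖ := by
  induction k with
  | zero =>
    obtain ⟨m, hm, hadm⟩ := W.exists_admissible_nsmul_of_isIntegral 2 P hP
    obtain ⟨x, y, h, hQ⟩ := exists_eq_some_of_not_isOfFinAddOrder hadm.1
    refine ⟨m, hm, x, y, h, hQ, hQ ▸ hadm, ?_⟩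
    rw [hQ] at hadm
    simpa using hadm.2.1
  | succ k ih =>
    obtain ⟨m, hm, x, y, h, hQ, hadm, hx⟩ := ih
    have hx1 : 1 < ‖(x : ℚ_[2])‖ := lt_of_le_of_lt (one_le_pow₀ (by norm_num)) hx
    have hx1' : 1 < padicNorm 2 x := by
      rw [Padic.eq_padicNorm] at hx1; exact_mod_cast hx1
    -- `Q` is not `2`-torsion
    have hy : y ≠ W.toAffine.negY x y := fun hneg => hadm.1 <| by
      refine isOfFinAddOrder_iff_nsmul_eq_zero.mpr ⟨2, two_pos, ?_⟩
      rw [two_nsmul, Affine.Point.add_self_of_Y_eq hneg]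
    have h2adm := isAdmissible_nsmul hadm two_ne_zero
    have h2Q : (2 : ℕ) • (Affine.Point.some x y h : W.toAffine.Point) =
        .some _ _ (Affine.nonsingular_add h h fun hxy => hy hxy.2) := by
      rw [two_nsmul, Affine.Point.add_self_of_Y_ne hy]
    refine ⟨2 * m, Nat.mul_ne_zero two_ne_zero hm, _, _, _, ?_, h2Q ▸ h2adm, ?_⟩
    · rw [mul_nsmul', hQ, h2Q]
    · have h4 := four_mul_padicNorm_le_padicNorm_addX h hx1' hy
      have h4' : 4 * ‖(x : ℚ_[2])‖ ≤
          ‖((W.toAffine.addX x x (W.toAffine.slope x x y y) : ℚ) : ℚ_[2])‖ := by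
        rw [Padic.eq_padicNorm, Padic.eq_padicNorm]; exact_mod_cast h4
      calc (4 : ℝ) ^ (k + 1) = 4 * 4 ^ k := by ring
        _ < 4 * ‖(x : ℚ_[2])‖ := by gcongr
        _ ≤ _ := h4'

/-- **A `2`-adic height datum is determined by its quadratic form on deep points with good reduction
everywhere**: two symmetric bilinear torsion-killing pairings `W(ℚ) × W(ℚ) → ℚ₂` whose quadratic forms
agree on every point `(x, y)` with `c ≤ ‖x‖₂` and non-singular reduction at all primes are equal (deep
admissible multiples + `PAdicHeightData.ext_of_sq_eq_on`).  With `c = 2⁸` this is the uniqueness of the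
`η`-height datum of the analytic lens (50U). [cite: MazurSteinTate2006, §1] -/
theorem heightData_eq_of_sq_eq_on_deep_two (W : WeierstrassCurve ℚ) [W.IsElliptic] [W.IsIntegral ℤ]
    (c : ℝ) {D₁ D₂ : PAdicHeightData W 2}
    (h : ∀ (x y : ℚ) (hxy : W.toAffine.Nonsingular x y), c ≤ ‖(x : ℚ_[2])‖ →
      (∀ ℓ : ℕ, ℓ.Prime → W.HasNonsingularReductionAt ℓ x y) →
      D₁.pairing (.some x y hxy) (.some x y hxy) = D₂.pairing (.some x y hxy) (.some x y hxy)) :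
    D₁ = D₂ := by
  -- some power of `4` exceeds `c`
  obtain ⟨k, hk⟩ : ∃ k : ℕ, c < (4 : ℝ) ^ k := pow_unbounded_of_one_lt c (by norm_num)
  refine PAdicHeightData.ext_of_sq_eq_on
    {Q | ∃ (x y : ℚ) (hxy : W.toAffine.Nonsingular x y), Q = .some x y hxy ∧ c ≤ ‖(x : ℚ_[2])‖ ∧
      ∀ ℓ : ℕ, ℓ.Prime → W.HasNonsingularReductionAt ℓ x y} (fun P hP => ?_) ?_
  · obtain ⟨m, hm, x, y, hxy, hQ, hadm, hx⟩ := exists_nsmul_isAdmissible_two_norm_gt W P hP k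
    exact ⟨m, hm, x, y, hxy, hQ, (hk.trans hx).le, hadm.2.2.2⟩
  · rintro Q ⟨x, y, hxy, rfl, hx, hred⟩
    exact h x y hxy hx hred

end Summit.BirchSwinnertonDyer.BirchSwinnertonDyer.Theorems.NaiveSigmaLogAtTwo
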